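import Literature.Geometry.Lorentzian.CauchyDevelopment
import Literature.Geometry.Lorentzian.KerrConvergence
import HarnessLib

/-!
# Orbiting a multi-Kerr configuration: `δ`-closeness, outside a compact set, of a vacuum Cauchy
# development to `N` boosted Kerr exteriors plus one asymptotically Cartesian chart

One interface definition, `VacuumCauchyDevelopment.OrbitsMultiKerr`, consumed by the route
`Summits/FinalStateConjecture/FinalStateConjecture/Theses/ResolvedTimelikeInfinity.lean` of the
final state conjecture, where it is the *seam* `ORBIT(𝒟; N, Mᵢ, aᵢ, (Λᵢ, cᵢ); q, k, δ)` shared —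
as one and the same inlined `∃`-block — by the two cruxes `ResolvedCapture` (hypothesis position:
"every MGHD which orbits the configuration at accuracy `(q, k, δ)` settles down") and
`OrbitFormation` (conclusion position: "generically every MGHD orbits some configuration to
every accuracy"). Naming the block lets both cruxes, and their future children (face rungs,
corner parametrix), be restated over one predicate.

## The notion (informal)

Fix a vacuum Cauchy development `𝒟 = (M, g, τ, ι, ν)` of data on the `3`-manifold `X`
(`VacuumCauchyDevelopment`, `CauchyDevelopment.lean`), a number `N` of holes with Kerr
parameters `(Mᵢ, aᵢ)` and Poincaré motions `(Λᵢ, cᵢ)` (`lorentzGroup × E4`), a spatial weight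
`q`, a differentiability order `k` and an accuracy `δ`. Then `𝒟.OrbitsMultiKerr N M a mot q k δ`
says: there are a late time `τ₀`, a far radius `ϱ₀`, excision radii `ρᵢ : ℝ → ℝ`, near-zone radii
`Rᵢ : ℝ → ℝ`, an open `U ⊆ E4`, hole charts `Ψᵢ` on the boosted Kerr exteriors
`boostedKerrExterior Λᵢ cᵢ Mᵢ aᵢ`, one chart `Ψ₀ : U → M` and a set `B ⊆ X` such that

1. each `Ψᵢ` is a late-time chart after `τ₀` (`Spacetime.IsLateChart`, region `univ`) modelled on
   the boosted Kerr–Schild background `boostedKerrBackground Λᵢ cᵢ Mᵢ aᵢ`;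
2. `Ψ₀` is smooth and an open embedding of all of `U`;
3. the tubes are sublinear, `ρᵢ(t)/t → 0`;
4. `U` contains the late half-space minus the tubes,
   `{τ₀ < x⁰, ∀ i, ρᵢ(x⁰) < rᵢ(Λᵢ⁻¹(x − cᵢ))}`, AND the far region `{-1 < x⁰, ϱ₀ + |x⁰| < |x̲|}`;
5. `B` is compact and the end of the initial slice is charted by the far region:
   `ι(X ∖ B) ⊆ Ψ₀(far region)`;
6. near-zone closeness: for every `τ ≥ τ₀` the `Cᵏ` deviation of `Ψᵢ^* g` from boosted Kerr on
   the truncated slab `{t*ᵢ = τ, rᵢ ≤ Rᵢ(τ)}` is `≤ δ` (`Spacetime.truncDeviationCk`);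
7. weighted flat closeness: at every late (`τ₀ < x⁰`) or far point `x` of `U` and every `m ≤ k`,
   `(1 + |x̲|)^q (1 + |x⁰ − |x̲||)^m ‖D^m (Ψ₀^* g − η)(x)‖ ≤ δ` (`Spacetime.deviationExtend` for the
   Minkowski background on `U`);
8. causal exhaustion at every later chart time `τ₁ > τ₀`: every point of the exterior region
   `O = J⁺(ι X) ∩ I⁻(late chart images)` which is neither in `Ψ₀({x⁰ > τ₁})` nor in some
   `Ψᵢ({t*ᵢ > τ₁, rᵢ ≤ Rᵢ(t*ᵢ)})` lies in the causal past of the certified slab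
   `Ψ₀({x⁰ = τ₁}) ∪ ⋃ᵢ Ψᵢ({t*ᵢ = τ₁, rᵢ ≤ Rᵢ(τ₁)})` — the raw-chart copy of clause (ii) of
   `Summit.FinalStateConjecture.HasExhaustiveCharts`.

This is the *orbital* (remains-close) counterpart, for `N` moving holes and outside a compact
spacetime region, of the *asymptotic* (converges) conclusion of the final state conjecture:
Dafermos–Luk, arXiv:1710.01722, Conjecture 1 (b) ("the geometry remains close to `g_{a₀,M₀}` in
`J⁻(𝓘⁺)`") is the printed `N = 1` instance of "remains close"; the `N`-hole picture (near zones
around receding Kerr holes plus a radiation zone converging to `η`) is Penrose 1982, Problem 12 /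
Klainerman, C. R. Mécanique 353 (2025), §1.1.1, rendered in the consequence-form `Cᵏ`-deviation
gauge of `KerrConvergence.lean` (DHRT arXiv:2104.08222, §1). **No printed formulation of the
predicate exists**: it is the route's own hypothesis predicate, and this file records it verbatim.

## Verbatim discipline (why the body looks the way it does)

The body of `OrbitsMultiKerr` is, token for token up to namespace shortening, the parenthesised
`∃`-block that occurs twice in the route file, with ONE change forced by the layering rule
"`Literature` never imports `Summits`": the route's `Summit.FinalStateConjecture.exteriorOf
𝒟.toCauchyDevelopment S` is replaced by ITS BODY
`𝒟.metric.causalFuture 𝒟.timeOrientation (Set.range 𝒟.embed) ∩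
𝒟.metric.chronologicalPast 𝒟.timeOrientation S` (which is also verbatim the body of
`Development.exteriorOf`, `FinalState.lean`). Since `exteriorOf` unfolds by `rfl`, the cruxes
restated over `OrbitsMultiKerr` are DEFINITIONALLY equal to the filed ones: with
`orbitsMultiKerr_iff` (`Iff.rfl`) in hand, `ResolvedCapture' ↔ ResolvedCapture` and
`OrbitFormation' ↔ OrbitFormation` are both `Iff.rfl` (checked in the literature-prover's scratch
file against the route file at rev 0). The weights (`0 < q < 1` in the cruxes, the `|u|`-gain
`(1 + |x⁰ − |x̲||)^m`), the far region and the compact-complement clause are the planner's design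
(route header, "Rationale"/"NUMBERS"); they are parameters/clauses here, not judged.

## API

`orbitsMultiKerr_iff` (unfolding, `Iff.rfl`), `OrbitsMultiKerr.mono` (monotone in `δ`),
`OrbitsMultiKerr.of_le` (antitone in `k`), `OrbitsMultiKerr.of_le_weight` (antitone in `q`).
Deliberately NOT here: the `N = 0` Minkowski sanity instance (the route's own falsifier test (b)),
any restatement of the cruxes (they live under `Summits/`), the `N`-centre Kerr–Schild
superposition (definition request D2 of the route, a separate notion).

## Mathlib

No Lorentzian geometry in Mathlib; only `Set` algebra, `TopologicalSpace.Opens`, `ContMDiff`,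
`Topology.IsOpenEmbedding`, `iteratedFDeriv`, `Real.rpow`, `ENNReal.ofReal`, `Filter.Tendsto` are
used. Nothing here duplicates Mathlib or the tree (`lean search OrbitsMultiKerr`: no hit).

## References

* M. Dafermos, J. Luk, *The interior of dynamical vacuum black holes I*, arXiv:1710.01722, §1.2.1
  (p. 8) and Conjecture 1 (b)–(c).
* R. Penrose, *Some unsolved problems in classical general relativity* (1982), Problem 12.
* S. Klainerman, *The black hole stability problem*, C. R. Mécanique 353 (2025), §1.1.1.
* M. Dafermos, G. Holzegel, I. Rodnianski, M. Taylor, arXiv:2104.08222, §1 (the `Cᵏ`-deviation,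
  "remains close" gauge).
-/

noncomputable section

open Set TopologicalSpace Filter Topology
open scoped Manifold ContDiff Topology ENNReal

universe u

namespace Literature.Geometry.Lorentzian

namespace VacuumCauchyDevelopment

variable {X : Type u} [TopologicalSpace X] [ChartedSpace E3 X] [IsManifold (𝓡 3) ∞ X]
  [ConnectedSpace X] {D : InitialDataSet (𝓡 3) X}

/-- **`𝒟` orbits the multi-Kerr configuration `(N; Mᵢ, aᵢ; Λᵢ, cᵢ)` at accuracy `(q, k, δ)`**
(the seam `ORBIT` of route `ResolvedTimelikeInfinity` of the final state conjecture, verbatim its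
inlined `∃`-block with `exteriorOf` unfolded; module docstring): there are a late time `τ₀`, a far
radius `ϱ₀`, sublinear excision radii `ρᵢ`, near-zone radii `Rᵢ`, an open `U ⊆ E4`, `N` boosted
Kerr–Schild late charts `Ψᵢ` (`IsLateChart`, region `univ`), one smooth open embedding
`Ψ₀ : U → M` with `U ⊇` (late half-space minus the tubes `rᵢ ≤ ρᵢ(x⁰)`) `∪` (far region
`{-1 < x⁰, ϱ₀ + |x⁰| < |x̲|}`), and a compact `B ⊆ X` with `ι(X ∖ B) ⊆ Ψ₀(far)`, such that
`Ψᵢ^* g` is `δ`-close in `Cᵏ` to boosted Kerr on every truncated slab `{t*ᵢ = τ, rᵢ ≤ Rᵢ(τ)}`,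
`τ ≥ τ₀`; `(1 + |x̲|)^q (1 + |x⁰ − |x̲||)^m ‖D^m(Ψ₀^* g − η)(x)‖ ≤ δ` for `m ≤ k` at every late or
far point `x` of `U`; and, for every chart time `τ₁ > τ₀`, every point of
`J⁺(ι X) ∩ I⁻(late chart images)` outside `Ψ₀({x⁰ > τ₁}) ∪ ⋃ᵢ Ψᵢ({t*ᵢ > τ₁, rᵢ ≤ Rᵢ(t*ᵢ)})` lies
in `J⁻(Ψ₀({x⁰ = τ₁}) ∪ ⋃ᵢ Ψᵢ({t*ᵢ = τ₁, rᵢ ≤ Rᵢ(τ₁)}))`. Orbital (remains-close) form, for `N`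
moving holes, of Dafermos–Luk, arXiv:1710.01722, Conjecture 1 (b) ("the geometry remains close
to `g_{a₀,M₀}`"), in the `N`-Kerr-plus-radiation picture of Penrose 1982, Problem 12, and the
`Cᵏ`-deviation gauge of DHRT arXiv:2104.08222, §1; no printed formulation of the predicate
itself exists (route-posited). [cite: DafermosLuk2017, Conjecture 1 (b)]
[cite: Penrose1982, Problem 12] [cite: arXiv210408222, §1] -/
def OrbitsMultiKerr (𝒟 : VacuumCauchyDevelopment D) (N : ℕ) (M a : Fin N → ℝ)
    (mot : Fin N → lorentzGroup × E4) (q : ℝ) (k : ℕ) (δ : ℝ) : Prop :=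
  ∃ (τ₀ ϱ₀ : ℝ) (ρ R : Fin N → ℝ → ℝ) (U : Opens E4)
    (Ψ : (i : Fin N) → boostedKerrExterior (mot i).1 (mot i).2 (M i) (a i) → 𝒟.carrier)
    (Ψ₀ : U → 𝒟.carrier) (B : Set X),
    -- (1) `N` boosted Kerr–Schild late charts after `τ₀`
    (∀ i, 𝒟.toSpacetime.IsLateChart (boostedKerrBackground (mot i).1 (mot i).2 (M i) (a i))
      univ τ₀ (Ψ i)) ∧
    -- (2) one smooth open embedding `Ψ₀` of `U`
    ContMDiff 𝓘(ℝ, E4) (𝓡 4) ∞ Ψ₀ ∧ IsOpenEmbedding Ψ₀ ∧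
    -- (3) sublinear excision tubes
    (∀ i, Tendsto (fun t : ℝ ↦ ρ i t / t) atTop (𝓝 0)) ∧
    -- (4) `U ⊇` (late half-space minus tubes) `∪` (far region)
    {x : E4 | (τ₀ < x 0 ∧ ∀ i, ρ i (x 0) < Kerr.radius (a i) (poincareInv (mot i).1 (mot i).2 x)) ∨
      (-1 < x 0 ∧ ϱ₀ + |x 0| < E4.spatialNorm x)} ⊆ (U : Set E4) ∧
    -- (5) the end of the initial slice is charted by the far region
    IsCompact B ∧
    𝒟.embed '' Bᶜ ⊆ Ψ₀ '' {x : U | -1 < x.1 0 ∧ ϱ₀ + |x.1 0| < E4.spatialNorm x.1} ∧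
    -- (6) near-zone `δ`-closeness to boosted Kerr out to radius `Rᵢ τ`
    (∀ i (τ : ℝ), τ₀ ≤ τ → 𝒟.toSpacetime.truncDeviationCk
      (boostedKerrBackground (mot i).1 (mot i).2 (M i) (a i)) (Ψ i) k (R i τ) τ ≤
        ENNReal.ofReal δ) ∧
    -- (7) weighted `δ`-closeness to `η` at every late or far point of `U`
    (∀ x : U, (τ₀ < x.1 0 ∨ (-1 < x.1 0 ∧ ϱ₀ + |x.1 0| < E4.spatialNorm x.1)) →
      ∀ m : ℕ, m ≤ k →
        (1 + E4.spatialNorm x.1) ^ q * (1 + |x.1 0 - E4.spatialNorm x.1|) ^ m *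
          ‖iteratedFDeriv ℝ m (𝒟.toSpacetime.deviationExtend (Minkowski.backgroundOn U) Ψ₀)
            x.1‖ ≤ δ) ∧
    -- (8) causal exhaustion at every later chart time, relative to `J⁺(ι X) ∩ I⁻(late images)`
    (∀ τ₁ : ℝ, τ₀ < τ₁ →
      (𝒟.metric.causalFuture 𝒟.timeOrientation (range 𝒟.embed) ∩
          𝒟.metric.chronologicalPast 𝒟.timeOrientation
            (Ψ₀ '' (Minkowski.backgroundOn U).lateRegion τ₀ ∪
              ⋃ i, Ψ i '' (boostedKerrBackground (mot i).1 (mot i).2 (M i) (a i)).lateRegion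
                τ₀)) \
          (Ψ₀ '' (Minkowski.backgroundOn U).lateRegion τ₁ ∪
            ⋃ i, Ψ i '' {x | τ₁ < (boostedKerrBackground (mot i).1 (mot i).2 (M i) (a i)).time
              x.1 ∧ (boostedKerrBackground (mot i).1 (mot i).2 (M i) (a i)).radius x.1 ≤
                R i ((boostedKerrBackground (mot i).1 (mot i).2 (M i) (a i)).time x.1)}) ⊆
        𝒟.metric.causalPast 𝒟.timeOrientation
          (Ψ₀ '' (Minkowski.backgroundOn U).timeSlab τ₁ ∪
            ⋃ i, Ψ i '' (boostedKerrBackground (mot i).1 (mot i).2 (M i) (a i)).truncTimeSlab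
              (R i τ₁) τ₁))

/-- Unfolding lemma for `OrbitsMultiKerr` (the clause list of the module docstring, with
`J⁺(ι X) ∩ I⁻(·)` written out), by `Iff.rfl`. Dafermos–Luk, arXiv:1710.01722, Conjecture 1 (b);
Penrose 1982, Problem 12. [cite: DafermosLuk2017, Conjecture 1 (b)] -/
theorem orbitsMultiKerr_iff (𝒟 : VacuumCauchyDevelopment D) (N : ℕ) (M a : Fin N → ℝ)
    (mot : Fin N → lorentzGroup × E4) (q : ℝ) (k : ℕ) (δ : ℝ) :
    𝒟.OrbitsMultiKerr N M a mot q k δ ↔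
      ∃ (τ₀ ϱ₀ : ℝ) (ρ R : Fin N → ℝ → ℝ) (U : Opens E4)
        (Ψ : (i : Fin N) → boostedKerrExterior (mot i).1 (mot i).2 (M i) (a i) → 𝒟.carrier)
        (Ψ₀ : U → 𝒟.carrier) (B : Set X),
        (∀ i, 𝒟.toSpacetime.IsLateChart (boostedKerrBackground (mot i).1 (mot i).2 (M i) (a i))
          univ τ₀ (Ψ i)) ∧
        ContMDiff 𝓘(ℝ, E4) (𝓡 4) ∞ Ψ₀ ∧ IsOpenEmbedding Ψ₀ ∧
        (∀ i, Tendsto (fun t : ℝ ↦ ρ i t / t) atTop (𝓝 0)) ∧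
        {x : E4 | (τ₀ < x 0 ∧
            ∀ i, ρ i (x 0) < Kerr.radius (a i) (poincareInv (mot i).1 (mot i).2 x)) ∨
          (-1 < x 0 ∧ ϱ₀ + |x 0| < E4.spatialNorm x)} ⊆ (U : Set E4) ∧
        IsCompact B ∧
        𝒟.embed '' Bᶜ ⊆ Ψ₀ '' {x : U | -1 < x.1 0 ∧ ϱ₀ + |x.1 0| < E4.spatialNorm x.1} ∧
        (∀ i (τ : ℝ), τ₀ ≤ τ → 𝒟.toSpacetime.truncDeviationCk
          (boostedKerrBackground (mot i).1 (mot i).2 (M i) (a i)) (Ψ i) k (R i τ) τ ≤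
            ENNReal.ofReal δ) ∧
        (∀ x : U, (τ₀ < x.1 0 ∨ (-1 < x.1 0 ∧ ϱ₀ + |x.1 0| < E4.spatialNorm x.1)) →
          ∀ m : ℕ, m ≤ k →
            (1 + E4.spatialNorm x.1) ^ q * (1 + |x.1 0 - E4.spatialNorm x.1|) ^ m *
              ‖iteratedFDeriv ℝ m
                (𝒟.toSpacetime.deviationExtend (Minkowski.backgroundOn U) Ψ₀) x.1‖ ≤ δ) ∧
        (∀ τ₁ : ℝ, τ₀ < τ₁ →
          (𝒟.metric.causalFuture 𝒟.timeOrientation (range 𝒟.embed) ∩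
              𝒟.metric.chronologicalPast 𝒟.timeOrientation
                (Ψ₀ '' (Minkowski.backgroundOn U).lateRegion τ₀ ∪
                  ⋃ i, Ψ i ''
                    (boostedKerrBackground (mot i).1 (mot i).2 (M i) (a i)).lateRegion τ₀)) \
              (Ψ₀ '' (Minkowski.backgroundOn U).lateRegion τ₁ ∪
                ⋃ i, Ψ i ''
                  {x | τ₁ < (boostedKerrBackground (mot i).1 (mot i).2 (M i) (a i)).time x.1 ∧
                    (boostedKerrBackground (mot i).1 (mot i).2 (M i) (a i)).radius x.1 ≤
                      R i ((boostedKerrBackground (mot i).1 (mot i).2 (M i) (a i)).time x.1)}) ⊆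
            𝒟.metric.causalPast 𝒟.timeOrientation
              (Ψ₀ '' (Minkowski.backgroundOn U).timeSlab τ₁ ∪
                ⋃ i, Ψ i ''
                  (boostedKerrBackground (mot i).1 (mot i).2 (M i) (a i)).truncTimeSlab
                    (R i τ₁) τ₁)) :=
  Iff.rfl

/-- Orbiting at accuracy `δ` implies orbiting at every coarser accuracy `δ' ≥ δ`, with the same
charts (both closeness clauses are upper bounds; `ENNReal.ofReal` is monotone). DHRT
arXiv:2104.08222, §1 ("remains close"). [cite: arXiv210408222, §1] -/
theorem OrbitsMultiKerr.mono {𝒟 : VacuumCauchyDevelopment D} {N : ℕ} {M a : Fin N → ℝ}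
    {mot : Fin N → lorentzGroup × E4} {q : ℝ} {k : ℕ} {δ δ' : ℝ}
    (h : 𝒟.OrbitsMultiKerr N M a mot q k δ) (hδ : δ ≤ δ') : 𝒟.OrbitsMultiKerr N M a mot q k δ' := by
  obtain ⟨τ₀, ϱ₀, ρ, R, U, Ψ, Ψ₀, B, h1, h2, h3, h4, h5, h6, h7, h8, h9, h10⟩ := h
  refine ⟨τ₀, ϱ₀, ρ, R, U, Ψ, Ψ₀, B, h1, h2, h3, h4, h5, h6, h7, fun i τ hτ ↦ ?_,
    fun x hx m hm ↦ (h9 x hx m hm).trans hδ, h10⟩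
  exact (h8 i τ hτ).trans (ENNReal.ofReal_le_ofReal hδ)

/-- Orbiting in `Cᵏ'` implies orbiting in `Cᵏ` for `k ≤ k'`, with the same charts and the same
accuracy (`Cᵏ` sup norms are monotone in `k`, `supCkENorm_mono_right`; the weighted clause is
asked for fewer `m`). DHRT arXiv:2104.08222, §1 (convergence with loss of derivatives).
[cite: arXiv210408222, §1] -/
theorem OrbitsMultiKerr.of_le {𝒟 : VacuumCauchyDevelopment D} {N : ℕ} {M a : Fin N → ℝ}
    {mot : Fin N → lorentzGroup × E4} {q : ℝ} {k k' : ℕ} {δ : ℝ}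
    (h : 𝒟.OrbitsMultiKerr N M a mot q k' δ) (hk : k ≤ k') : 𝒟.OrbitsMultiKerr N M a mot q k δ := by
  obtain ⟨τ₀, ϱ₀, ρ, R, U, Ψ, Ψ₀, B, h1, h2, h3, h4, h5, h6, h7, h8, h9, h10⟩ := h
  refine ⟨τ₀, ϱ₀, ρ, R, U, Ψ, Ψ₀, B, h1, h2, h3, h4, h5, h6, h7, fun i τ hτ ↦ ?_,
    fun x hx m hm ↦ h9 x hx m (hm.trans hk), h10⟩
  exact (supCkENorm_mono_right _ hk _).trans (h8 i τ hτ)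

/-- Orbiting with spatial weight `q'` implies orbiting with every smaller weight `q ≤ q'`, with
the same charts and accuracy (`(1 + |x̲|)^q ≤ (1 + |x̲|)^{q'}` since `1 ≤ 1 + |x̲|`,
`Real.rpow_le_rpow_of_exponent_le`). DHRT arXiv:2104.08222, §1. [cite: arXiv210408222, §1] -/
theorem OrbitsMultiKerr.of_le_weight {𝒟 : VacuumCauchyDevelopment D} {N : ℕ} {M a : Fin N → ℝ}
    {mot : Fin N → lorentzGroup × E4} {q q' : ℝ} {k : ℕ} {δ : ℝ}
    (h : 𝒟.OrbitsMultiKerr N M a mot q' k δ) (hq : q ≤ q') :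
    𝒟.OrbitsMultiKerr N M a mot q k δ := by
  obtain ⟨τ₀, ϱ₀, ρ, R, U, Ψ, Ψ₀, B, h1, h2, h3, h4, h5, h6, h7, h8, h9, h10⟩ := h
  refine ⟨τ₀, ϱ₀, ρ, R, U, Ψ, Ψ₀, B, h1, h2, h3, h4, h5, h6, h7, h8, fun x hx m hm ↦ ?_, h10⟩
  refine le_trans ?_ (h9 x hx m hm)
  have hr : (1 : ℝ) ≤ 1 + E4.spatialNorm x.1 :=
    le_add_of_nonneg_right (E4.spatialNorm_nonneg x.1)
  gcongr

end VacuumCauchyDevelopment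

end Literature.Geometry.Lorentzian

end
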